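import Literature.NumberTheory.LFunctions.VanDerCorputZeta
import Literature.NumberTheory.Sieve.VinogradovExpSumTools
import HarnessLib

/-!
# Two lemmas of Vinogradov's method: geometric sums and the sum `∑ min(U, 1/‖αn + β‖)`

Topic `Literature/NumberTheory/LFunctions`.  Everything in this file is PROVED; no definitions, no named facts.
The distance to the nearest integer `‖x‖ = distInt x` and the majorant `geomBound V x = min(V, 1/(2‖x‖))` (read
as `V` when `‖x‖ = 0`) are those of `Literature/NumberTheory/Sieve/VinogradovExpSumTools.lean`
(namespace `Sieve.Vinogradov`, Nathanson's Lemmas 4.6–4.10), whose elementary API is reused.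

These are Lemmas 6.4 and 6.5 of A. Ivić, *The Riemann Zeta-Function* (Wiley 1985), §6.3 — the two
"simple, technical lemmas" used in the proof of Theorem 6.2 there (the Vinogradov–Korobov estimate of the
zeta sums `∑_{N < n ≤ N₁} n^{it}`), with unoptimised absolute constants:

* `norm_sum_e_mul_le_geomBound` — **Lemma 6.4**: for real `x` and the `L` consecutive integers
  `n₀ < n ≤ n₀ + L` (`n₀ ∈ ℤ`), `‖∑ e(xn)‖ ≤ min(L, 1/(2‖x‖)) = geomBound L x` (`e = VdC.e`; the Sieve file has
  it for `𝐞` and natural endpoints);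
* `sum_geomBound_linear_le` — **Lemma 6.5**: if `|α - a/q| ≤ 1/q²` with `(a, q) = 1`, `q ≥ 1`, then for every
  real `β`, `U ≥ 0`, every `n₀ ∈ ℤ` and `M ∈ ℕ`,
  `∑_{n₀ < n ≤ n₀ + M} geomBound U (αn + β) ≤ (M/q + 1)(6U + 6q(1 + log(q+1)))`
  (Ivić: `≤ 6(N/q + 1)(U + q log q)` for `∑_{n ≤ N} min(U, 1/‖αn + β‖)`), and `sum_geomBound_linear_Icc_le`,
  the same over `|μ| ≤ M` with `β = 0`.

## Proofs
Lemma 6.4: `∑_{n₀ < n ≤ n₀+L} e(xn) = e(x(n₀+1)) (e(x)^L − 1)/(e(x) − 1)` and `|e(x) − 1| = 2|sin πx| ≥ 4‖x‖`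
(Jordan's inequality, `Sieve.Vinogradov.two_mul_distInt_le_abs_sin`).  Lemma 6.5 (Ivić p. 120–121): on a block of `q` consecutive `n = n₀ + i`, `1 ≤ i ≤ q`,
write `αn + β = (ai + c)/q + ψ_i/q` with `c = ⌊q(αn₀ + β)⌋` and `|ψ_i| ≤ 2`; the integers `m_i = ai + c` are
pairwise incongruent mod `q`, so their residues `m̃_i ∈ [-q/2, q/2)` are distinct, and
`‖αn + β‖ ≥ (|m̃_i| − 2)/q`; hence the block contributes at most `5U + ∑_{3 ≤ |m̃| ≤ q} q/(2(|m̃| − 2)) ≤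
6U + 6q(1 + log(q+1))` (we bound through the fibres of `i ↦ |m̃_i|`), and `M` consecutive integers are covered by
`⌈M/q⌉ ≤ M/q + 1` blocks.

## References
* M. B. Nathanson, *Additive Number Theory: the Classical Bases*, GTM 164, Springer 1996, §4.4 (Lemmas 4.6–4.8) — via
  `VinogradovExpSumTools.lean`. [cite: Nathanson1996, §4.4]
* A. Ivić, *The Riemann Zeta-Function*, John Wiley & Sons 1985 (Dover 2003), §6.3, Lemma 6.4, Lemma 6.5.
  [cite: Ivic1985, Lemma 6.4] [cite: Ivic1985, Lemma 6.5]
-/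

noncomputable section

open Finset Real

namespace Literature.NumberTheory.LFunctions
namespace VinogradovZetaSum

open VdC (e)
open Sieve.Vinogradov

/-! ### Complements on the distance to the nearest integer (`Sieve.Vinogradov.distInt`) -/

/-- `‖x‖ ≤ ‖y‖ + |x − y|` (the distance to the nearest integer is `1`-Lipschitz). [folklore] -/
theorem distInt_le_distInt_add_abs_sub (x y : ℝ) : distInt x ≤ distInt y + |x - y| := by
  calc distInt x ≤ |x - round y| := distInt_le_abs_sub_int x (round y)
    _ = |(y - round y) + (x - y)| := by ring_nf
    _ ≤ |y - round y| + |x - y| := abs_add_le _ _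
    _ = distInt y + |x - y| := rfl

/-- The representative `m̃ = m − q·round(m/q)` of `m` modulo `q` satisfies `|m̃| ≤ q/2` (`q ≥ 1`).
[folklore] -/
theorem abs_rep_le {q : ℕ} (hq : 0 < q) (m : ℤ) :
    |((m - q * round ((m : ℝ) / q) : ℤ) : ℝ)| ≤ q / 2 := by
  have hq' : (0 : ℝ) < q := by exact_mod_cast hq
  have h := abs_sub_round ((m : ℝ) / q)
  have : ((m - q * round ((m : ℝ) / q) : ℤ) : ℝ) = q * ((m : ℝ) / q - round ((m : ℝ) / q)) := by
    push_cast
    field_simp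
  rw [this, abs_mul, abs_of_pos hq']
  calc (q : ℝ) * |(m : ℝ) / q - round ((m : ℝ) / q)| ≤ q * (1 / 2) :=
        mul_le_mul_of_nonneg_left h hq'.le
    _ = q / 2 := by ring

/-- For `|y| ≤ 1/2`: `‖y‖ = |y|`. [folklore] -/
theorem distInt_eq_abs_of_abs_le_half {y : ℝ} (hy : |y| ≤ 1 / 2) : distInt y = |y| := by
  apply le_antisymm
  · simpa using distInt_le_abs_sub_int y 0
  · -- `|y| ≤ |y - m|` for the integer `m = round y`: if `m = 0` equality, else `|y - m| ≥ |m| - |y| ≥ 1/2 ≥ |y|`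
    unfold distInt
    rcases eq_or_ne (round y) 0 with h0 | h0
    · rw [h0]; simp
    · have h1 : (1 : ℝ) ≤ |(round y : ℝ)| := by
        rw [← Int.cast_abs]; exact_mod_cast Int.one_le_abs h0
      have h2 : |(round y : ℝ)| - |y| ≤ |y - round y| := by
        have := abs_sub_abs_le_abs_sub (round y : ℝ) y
        rwa [abs_sub_comm] at this
      linarith

/-- The key lower bound behind Lemma 6.5: for an integer `m̃` with `|m̃| ≤ q/2` and a real `ψ`,
`‖(m̃ + ψ)/q‖ ≥ (|m̃| − |ψ|)/q` (`q ≥ 1`). [cite: Ivic1985, Lemma 6.5 (proof)] -/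
theorem distInt_rep_ge {q : ℕ} (hq : 0 < q) {mt : ℤ} (hmt : |(mt : ℝ)| ≤ q / 2) (ψ : ℝ) :
    (|(mt : ℝ)| - |ψ|) / q ≤ distInt (((mt : ℝ) + ψ) / q) := by
  have hq' : (0 : ℝ) < q := by exact_mod_cast hq
  have h1 : distInt ((mt : ℝ) / q) = |(mt : ℝ)| / q := by
    rw [distInt_eq_abs_of_abs_le_half, abs_div, abs_of_pos hq']
    rw [abs_div, abs_of_pos hq', div_le_iff₀ hq']
    linarith
  have h2 := distInt_le_distInt_add_abs_sub ((mt : ℝ) / q) (((mt : ℝ) + ψ) / q)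
  have h3 : |(mt : ℝ) / q - ((mt : ℝ) + ψ) / q| = |ψ| / q := by
    rw [show (mt : ℝ) / q - ((mt : ℝ) + ψ) / q = -(ψ / q) by ring, abs_neg, abs_div, abs_of_pos hq']
  rw [h1, h3] at h2
  rw [sub_div]
  linarith

/-! ### Lemma 6.4: geometric sums of `e(xn)` over integer ranges -/

/-- `|e(x) − 1| ≥ 4‖x‖` for `e = VdC.e`, since `|e(x) − 1| = 2|sin(πx)|` (cf.
`Sieve.Vinogradov.norm_fourierChar_sub_one` for `𝐞`) and `|sin(πx)| ≥ 2‖x‖`. [folklore] -/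
theorem four_mul_distInt_le_norm_e_sub_one (x : ℝ) : 4 * distInt x ≤ ‖e x - 1‖ := by
  have hnorm : ‖e x - 1‖ = 2 * |Real.sin (π * x)| := by
    have h : e x = Complex.exp (Complex.I * ((2 * π * x : ℝ) : ℂ)) := by
      unfold VdC.e; rw [mul_comm]
    rw [h, Complex.norm_exp_I_mul_ofReal_sub_one, Real.norm_eq_abs, abs_mul, abs_two]
    congr 2
    ring
  rw [hnorm]
  linarith [two_mul_distInt_le_abs_sin x]

/-- `geomBound U (x + m) = geomBound U x` for integers `m`. [folklore] -/
theorem geomBound_add_int (U x : ℝ) (m : ℤ) : geomBound U (x + m) = geomBound U x := by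
  unfold geomBound; rw [distInt_add_int]

/-- If `‖x‖ ≥ d > 0` then `geomBound U x ≤ 1/(2d)`. [folklore] -/
theorem geomBound_le_of_le_distInt {U x d : ℝ} (hd : 0 < d) (h : d ≤ distInt x) :
    geomBound U x ≤ 1 / (2 * d) := by
  refine (geomBound_le_inv U (hd.trans_le h)).trans ?_
  gcongr

/-- The geometric sum over `L` consecutive integers: `∑_{n₀ < n ≤ n₀ + L} e(xn) = e(x(n₀+1)) ∑_{i<L} e(x)^i`.
[folklore] -/
theorem sum_e_mul_Ioc_eq (x : ℝ) (n₀ : ℤ) (L : ℕ) :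
    ∑ n ∈ Finset.Ioc n₀ (n₀ + L), e (x * n) = e (x * (n₀ + 1)) * ∑ i ∈ range L, e x ^ i := by
  induction L with
  | zero => simp
  | succ L ih =>
    rw [sum_range_succ, mul_add, ← ih]
    have h : Finset.Ioc n₀ (n₀ + ((L + 1 : ℕ) : ℤ)) = insert (n₀ + L + 1) (Finset.Ioc n₀ (n₀ + L)) := by
      ext n; simp only [Finset.mem_Ioc, Finset.mem_insert, Nat.cast_add, Nat.cast_one]; omega
    rw [h, sum_insert (by simp), add_comm]
    congr 1
    have he : ∀ k : ℕ, e x ^ k = e (x * k) := by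
      intro k
      induction k with
      | zero => simp [VdC.e_zero]
      | succ k ihk => rw [pow_succ, ihk, ← VdC.e_add]; congr 1; push_cast; ring
    rw [he, ← VdC.e_add]
    congr 1; push_cast; ring

/-- **Ivić, Lemma 6.4**: `‖∑_{n₀ < n ≤ n₀+L} e(xn)‖ ≤ geomBound L x = min(L, 1/(2‖x‖))` (`n₀ ∈ ℤ`).
[cite: Ivic1985, Lemma 6.4] -/
theorem norm_sum_e_mul_le_geomBound (x : ℝ) (n₀ : ℤ) (L : ℕ) :
    ‖∑ n ∈ Finset.Ioc n₀ (n₀ + L), e (x * n)‖ ≤ geomBound L x := by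
  have htriv : ‖∑ n ∈ Finset.Ioc n₀ (n₀ + L), e (x * n)‖ ≤ L := by
    refine (norm_sum_le _ _).trans ?_
    simp [VdC.norm_e]
  unfold geomBound
  split_ifs with h0
  · exact htriv
  · refine le_min htriv ?_
    rw [sum_e_mul_Ioc_eq, norm_mul, VdC.norm_e, one_mul]
    have hne : e x ≠ 1 := by
      intro h1
      have := four_mul_distInt_le_norm_e_sub_one x
      rw [h1, sub_self, norm_zero] at this
      exact h0 (by linarith [distInt_nonneg x])
    rw [geom_sum_eq hne, norm_div]
    have hd : 0 < distInt x := lt_of_le_of_ne (distInt_nonneg x) (Ne.symm h0)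
    have hden : 4 * distInt x ≤ ‖e x - 1‖ := four_mul_distInt_le_norm_e_sub_one x
    have hnum : ‖e x ^ L - 1‖ ≤ 2 := by
      refine (norm_sub_le _ _).trans ?_
      rw [norm_pow, VdC.norm_e, one_pow, norm_one]; norm_num
    have hpos : 0 < ‖e x - 1‖ := by linarith
    rw [div_le_div_iff₀ hpos (by positivity)]
    nlinarith

/-! ### Lemma 6.5: the sum of `min(U, 1/‖αn + β‖)` over consecutive integers -/

/-- The block constant `6U + 6q(1 + log(q+1))` of Lemma 6.5. [folklore] -/
theorem blockConst_nonneg {U : ℝ} (hU : 0 ≤ U) (q : ℕ) : 0 ≤ 6 * U + 6 * q * (1 + Real.log (q + 1)) := by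
  have : 0 ≤ Real.log (q + 1) := Real.log_nonneg (by linarith [(Nat.cast_nonneg q : (0 : ℝ) ≤ q)])
  positivity

/-- `∑_{t < q+1} 1/(t+1) ≤ 1 + log(q+1)` (the harmonic number `H_{q+1}`). [folklore] -/
theorem sum_range_inv_succ_le (q : ℕ) : ∑ t ∈ range (q + 1), 1 / ((t : ℝ) + 1) ≤ 1 + Real.log (q + 1) := by
  have h := harmonic_le_one_add_log (q + 1)
  have : ∑ t ∈ range (q + 1), 1 / ((t : ℝ) + 1) = ((harmonic (q + 1) : ℚ) : ℝ) := by
    unfold harmonic; push_cast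
    refine sum_congr rfl fun t _ => by rw [one_div]
  rw [this]; push_cast at h; exact h

/-- One block of `q` consecutive integers: if `|α − a/q| ≤ 1/q²`, `(a, q) = 1`, `q ≥ 1`, `U ≥ 0`, then
`∑_{n₀ < n ≤ n₀ + q} geomBound U (αn + β) ≤ 6U + 6q(1 + log(q+1))`. [cite: Ivic1985, Lemma 6.5 (proof, (6.35))] -/
theorem sum_geomBound_linear_block_le {α β U : ℝ} (hU : 0 ≤ U) {a : ℤ} {q : ℕ} (hq : 0 < q) (hcop : IsCoprime a (q : ℤ))
    (hα : |α - a / q| ≤ 1 / (q : ℝ) ^ 2) (n₀ : ℤ) :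
    ∑ n ∈ Finset.Ioc n₀ (n₀ + q), geomBound U (α * n + β) ≤ 6 * U + 6 * q * (1 + Real.log (q + 1)) := by
  have hq' : (0 : ℝ) < q := by exact_mod_cast hq
  -- θ with α = a/q + θ/q²
  set θ : ℝ := (α - a / q) * (q : ℝ) ^ 2 with hθ
  have hθ1 : |θ| ≤ 1 := by
    rw [hθ, abs_mul, abs_of_pos (by positivity : (0 : ℝ) < (q : ℝ) ^ 2)]
    calc |α - a / q| * (q : ℝ) ^ 2 ≤ 1 / (q : ℝ) ^ 2 * (q : ℝ) ^ 2 := by gcongr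
      _ = 1 := by field_simp
  have hαeq : α = a / q + θ / (q : ℝ) ^ 2 := by rw [hθ]; field_simp; ring
  -- β₁ = α n₀ + β, c = ⌊q β₁⌋, φ = the fractional part
  set β₁ : ℝ := α * n₀ + β with hβ₁
  set c : ℤ := ⌊(q : ℝ) * β₁⌋ with hc
  set φ : ℝ := (q : ℝ) * β₁ - c with hφ
  have hφ0 : 0 ≤ φ := by rw [hφ, hc]; exact Int.fract_nonneg _
  have hφ1 : φ < 1 := by rw [hφ, hc]; exact Int.fract_lt_one _
  -- the residue representative of `m_i = a i + c` in `[-q/2, q/2]`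
  let rep : ℤ → ℤ := fun i => (a * i + c) - q * round (((a * i + c : ℤ) : ℝ) / q)
  -- the majorant `G(t) = U·[t ≤ 2] + 3q/(t+1)` of `geomBound` as a function of `t = |rep i|`
  let G : ℕ → ℝ := fun t => (if t ≤ 2 then U else 0) + 3 * q / ((t : ℝ) + 1)
  have hG0 : ∀ t, 0 ≤ G t := by
    intro t; simp only [G]
    have : 0 ≤ 3 * (q : ℝ) / ((t : ℝ) + 1) := by positivity
    split_ifs <;> linarith
  -- (1) pointwise bound on the block
  have hpt : ∀ i : ℤ, 1 ≤ i → i ≤ q → geomBound U (α * (n₀ + i) + β) ≤ G (rep i).natAbs := by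
    intro i hi1 hiq
    -- α(n₀+i)+β = (a i + c)/q + ψ/q, ψ = φ + θ i/q, |ψ| ≤ 2
    set ψ : ℝ := φ + θ * i / q with hψ
    have hψ2 : |ψ| ≤ 2 := by
      have hi0 : (0 : ℝ) ≤ i := by exact_mod_cast (by omega : (0 : ℤ) ≤ i)
      have hiq' : (i : ℝ) ≤ q := by exact_mod_cast hiq
      have h1 : |θ * i / q| ≤ 1 := by
        rw [abs_div, abs_mul, abs_of_pos hq', abs_of_nonneg hi0, div_le_one hq']
        calc |θ| * i ≤ 1 * q := by gcongr
          _ = q := one_mul _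
      calc |ψ| ≤ |φ| + |θ * i / q| := abs_add_le _ _
        _ ≤ 1 + 1 := by rw [abs_of_nonneg hφ0]; exact add_le_add hφ1.le h1
        _ = 2 := by norm_num
    have hval : α * (n₀ + i) + β = (((a * i + c : ℤ) : ℝ) + ψ) / q := by
      have : α * (n₀ + i) + β = α * i + β₁ := by rw [hβ₁]; ring
      rw [this, hαeq, hψ]
      have hb : β₁ = (c + φ) / q := by rw [hφ]; field_simp; ring
      rw [hb]; push_cast; field_simp; ring
    -- pass to the representative
    have hrepval : (((a * i + c : ℤ) : ℝ) + ψ) / q =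
        (((rep i : ℤ) : ℝ) + ψ) / q + (round (((a * i + c : ℤ) : ℝ) / q) : ℤ) := by
      simp only [rep]; push_cast; field_simp; ring
    have hrep_le : |((rep i : ℤ) : ℝ)| ≤ q / 2 := abs_rep_le hq (a * i + c)
    have habs : (((rep i).natAbs : ℕ) : ℝ) = |((rep i : ℤ) : ℝ)| := by
      rw [← Int.cast_abs, Nat.cast_natAbs]
    rw [hval, hrepval, geomBound_add_int]
    have hlow := distInt_rep_ge hq hrep_le ψ
    simp only [G]
    have hpos3 : 0 ≤ 3 * (q : ℝ) / ((((rep i).natAbs : ℕ) : ℝ) + 1) := by positivity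
    split_ifs with h2
    · linarith [geomBound_le U ((((rep i : ℤ) : ℝ) + ψ) / q)]
    · push Not at h2
      have h3 : (3 : ℝ) ≤ |((rep i : ℤ) : ℝ)| := by
        rw [← habs]; exact_mod_cast h2
      have hdpos : 0 < (|((rep i : ℤ) : ℝ)| - 2) / q := by
        apply div_pos _ hq'; linarith
      have hdle : (|((rep i : ℤ) : ℝ)| - 2) / q ≤ distInt ((((rep i : ℤ) : ℝ) + ψ) / q) :=
        le_trans (by gcongr) hlow
      refine (geomBound_le_of_le_distInt hdpos hdle).trans ?_
      rw [zero_add, habs]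
      -- q/(2(T-2)) ≤ 3q/(T+1) for T ≥ 3
      rw [div_le_div_iff₀ (by positivity) (by linarith)]
      have hsimp : 3 * (q : ℝ) * (2 * ((|((rep i : ℤ) : ℝ)| - 2) / q)) = 6 * (|((rep i : ℤ) : ℝ)| - 2) := by
        field_simp; ring
      rw [hsimp]
      linarith
  -- (2) injectivity of `rep` on the block
  have hinj : Set.InjOn rep (Finset.Ioc (0 : ℤ) q : Set ℤ) := by
    intro i hi j hj hij
    simp only [Finset.coe_Ioc, Set.mem_Ioc] at hi hj
    simp only [rep] at hij
    have hdvd : (q : ℤ) ∣ a * (i - j) := by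
      refine ⟨round (((a * i + c : ℤ) : ℝ) / q) - round (((a * j + c : ℤ) : ℝ) / q), ?_⟩
      linear_combination hij
    have hdvd' : (q : ℤ) ∣ i - j := (IsCoprime.symm hcop).dvd_of_dvd_mul_left hdvd
    obtain ⟨m, hm⟩ := hdvd'
    have hm0 : m = 0 := by
      by_contra hm0
      have h1 : (q : ℤ) ≤ |i - j| := by
        rw [hm, abs_mul, Nat.abs_cast]
        calc (q : ℤ) = q * 1 := (mul_one _).symm
          _ ≤ q * |m| := by gcongr; exact Int.one_le_abs hm0
      have h2 : |i - j| < q := by rw [abs_lt]; constructor <;> omega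
      omega
    rw [hm0, mul_zero, sub_eq_zero] at hm
    exact hm
  -- (3) reindex the block by `i = n - n₀`
  have hshift : ∑ n ∈ Finset.Ioc n₀ (n₀ + q), geomBound U (α * n + β) =
      ∑ i ∈ Finset.Ioc (0 : ℤ) q, geomBound U (α * (n₀ + i) + β) := by
    have hI : Finset.Ioc n₀ (n₀ + q) = (Finset.Ioc (0 : ℤ) q).image (fun i => n₀ + i) := by
      rw [Finset.image_add_left_Ioc]; simp
    rw [hI, sum_image (fun i _ j _ h => by linarith)]
    refine sum_congr rfl fun i _ => ?_
    push_cast; ring_nf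
  have hstep1 : ∑ i ∈ Finset.Ioc (0 : ℤ) q, geomBound U (α * (n₀ + i) + β) ≤
      ∑ i ∈ Finset.Ioc (0 : ℤ) q, G (rep i).natAbs := by
    refine sum_le_sum fun i hi => ?_
    rw [Finset.mem_Ioc] at hi
    exact hpt i (by omega) hi.2
  -- (4) fibres of `i ↦ |rep i|` have at most two elements, and `|rep i| ≤ q`
  have hmaps : ∀ i ∈ Finset.Ioc (0 : ℤ) q, (rep i).natAbs ∈ range (q + 1) := by
    intro i _
    have h := abs_rep_le hq (a * i + c)
    have h' : |((rep i : ℤ) : ℝ)| ≤ q := h.trans (by linarith)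
    rw [← Int.cast_abs] at h'
    have h'' : |rep i| ≤ q := by exact_mod_cast h'
    rw [Finset.mem_range]
    have : ((rep i).natAbs : ℤ) ≤ q := by rw [Int.natCast_natAbs]; exact h''
    omega
  have hfib : ∀ t ∈ range (q + 1),
      ∑ i ∈ (Finset.Ioc (0 : ℤ) q).filter (fun i => (rep i).natAbs = t), G (rep i).natAbs ≤ 2 * G t := by
    intro t _
    have hc2 : (((Finset.Ioc (0 : ℤ) q).filter (fun i => (rep i).natAbs = t)).card : ℝ) ≤ 2 := by
      have hsub : ((Finset.Ioc (0 : ℤ) q).filter (fun i => (rep i).natAbs = t)).image rep ⊆ {(t : ℤ), -(t : ℤ)} := by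
        intro m hm
        obtain ⟨i, hi, rfl⟩ := mem_image.1 hm
        rw [mem_filter] at hi
        rw [Finset.mem_insert, Finset.mem_singleton]
        rcases Int.natAbs_eq (rep i) with h | h
        · left; rw [h, hi.2]
        · right; rw [h, hi.2]
      have hinj' : Set.InjOn rep ((Finset.Ioc (0 : ℤ) q).filter (fun i => (rep i).natAbs = t) : Set ℤ) :=
        hinj.mono (by intro i hi; simp only [coe_filter, Set.mem_setOf_eq] at hi; exact hi.1)
      have h1 := card_image_of_injOn hinj'
      have h2 := card_le_card hsub
      have h3 : ({(t : ℤ), -(t : ℤ)} : Finset ℤ).card ≤ 2 := Finset.card_le_two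
      have : ((Finset.Ioc (0 : ℤ) q).filter (fun i => (rep i).natAbs = t)).card ≤ 2 := by
        rw [← h1]; exact h2.trans h3
      exact_mod_cast this
    calc ∑ i ∈ (Finset.Ioc (0 : ℤ) q).filter (fun i => (rep i).natAbs = t), G (rep i).natAbs
        = ∑ i ∈ (Finset.Ioc (0 : ℤ) q).filter (fun i => (rep i).natAbs = t), G t := by
          refine sum_congr rfl fun i hi => ?_
          rw [mem_filter] at hi; rw [hi.2]
      _ = (((Finset.Ioc (0 : ℤ) q).filter (fun i => (rep i).natAbs = t)).card : ℝ) * G t := by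
          rw [sum_const, nsmul_eq_mul]
      _ ≤ 2 * G t := by gcongr
  have hstep2 : ∑ i ∈ Finset.Ioc (0 : ℤ) q, G (rep i).natAbs ≤ ∑ t ∈ range (q + 1), 2 * G t := by
    rw [← sum_fiberwise_of_maps_to hmaps]
    exact sum_le_sum hfib
  -- (5) the majorant sum
  have hstep3 : ∑ t ∈ range (q + 1), 2 * G t ≤ 6 * U + 6 * q * (1 + Real.log (q + 1)) := by
    rw [← mul_sum]
    have hsplit : ∑ t ∈ range (q + 1), G t =
        ∑ t ∈ range (q + 1), (if t ≤ 2 then U else 0) + 3 * q * ∑ t ∈ range (q + 1), 1 / ((t : ℝ) + 1) := by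
      simp only [G]; rw [sum_add_distrib, mul_sum]
      congr 1; refine sum_congr rfl fun t _ => ?_; ring
    have hind : ∑ t ∈ range (q + 1), (if t ≤ 2 then U else (0 : ℝ)) ≤ 3 * U := by
      rw [← sum_filter]
      have hsub : (range (q + 1)).filter (fun t => t ≤ 2) ⊆ range 3 := by
        intro t ht; rw [mem_filter] at ht; rw [Finset.mem_range]; omega
      calc ∑ t ∈ (range (q + 1)).filter (fun t => t ≤ 2), U ≤ ∑ t ∈ range 3, U :=
            sum_le_sum_of_subset_of_nonneg hsub fun _ _ _ => hU
        _ = 3 * U := by simp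
    have hharm := sum_range_inv_succ_le q
    rw [hsplit]
    have : 3 * (q : ℝ) * ∑ t ∈ range (q + 1), 1 / ((t : ℝ) + 1) ≤ 3 * q * (1 + Real.log (q + 1)) := by gcongr
    linarith
  calc ∑ n ∈ Finset.Ioc n₀ (n₀ + q), geomBound U (α * n + β)
      = ∑ i ∈ Finset.Ioc (0 : ℤ) q, geomBound U (α * (n₀ + i) + β) := hshift
    _ ≤ ∑ i ∈ Finset.Ioc (0 : ℤ) q, G (rep i).natAbs := hstep1
    _ ≤ ∑ t ∈ range (q + 1), 2 * G t := hstep2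
    _ ≤ 6 * U + 6 * q * (1 + Real.log (q + 1)) := hstep3

/-- **Ivić, Lemma 6.5**: if `|α − a/q| ≤ 1/q²` with `(a, q) = 1`, `q ≥ 1`, then for all real `β`, `U ≥ 0`,
`n₀ ∈ ℤ`, `M ∈ ℕ`: `∑_{n₀ < n ≤ n₀ + M} min(U, 1/(2‖αn + β‖)) ≤ (M/q + 1)(6U + 6q(1 + log(q+1)))`
(Ivić: `6(N/q + 1)(U + q log q)`). [cite: Ivic1985, Lemma 6.5] -/
theorem sum_geomBound_linear_le {α β U : ℝ} (hU : 0 ≤ U) {a : ℤ} {q : ℕ} (hq : 0 < q) (hcop : IsCoprime a (q : ℤ))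
    (hα : |α - a / q| ≤ 1 / (q : ℝ) ^ 2) (n₀ : ℤ) (M : ℕ) :
    ∑ n ∈ Finset.Ioc n₀ (n₀ + M), geomBound U (α * n + β) ≤
      ((M : ℝ) / q + 1) * (6 * U + 6 * q * (1 + Real.log (q + 1))) := by
  have hq' : (0 : ℝ) < q := by exact_mod_cast hq
  -- number of blocks
  set B : ℕ := M / q + 1 with hB
  have hMB : M ≤ B * q := by
    rw [hB, add_mul, one_mul]
    have h1 := Nat.div_add_mod M q
    have h2 := Nat.mod_lt M hq
    have h3 : M / q * q = q * (M / q) := mul_comm _ _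
    omega
  have hBle : (B : ℝ) ≤ (M : ℝ) / q + 1 := by
    rw [hB]; push_cast
    gcongr
    rw [le_div_iff₀ hq']
    exact_mod_cast Nat.div_mul_le_self M q
  -- pad the range to `B q` terms
  have hpad : ∑ n ∈ Finset.Ioc n₀ (n₀ + M), geomBound U (α * n + β) ≤
      ∑ n ∈ Finset.Ioc n₀ (n₀ + ((B * q : ℕ) : ℤ)), geomBound U (α * n + β) := by
    refine sum_le_sum_of_subset_of_nonneg (Finset.Ioc_subset_Ioc_right ?_) ?_
    · have : (M : ℤ) ≤ ((B * q : ℕ) : ℤ) := by exact_mod_cast hMB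
      linarith
    · intro n _ _; exact geomBound_nonneg hU _
  -- sum over blocks
  have hblocks : ∀ b : ℕ, ∑ n ∈ Finset.Ioc n₀ (n₀ + ((b * q : ℕ) : ℤ)), geomBound U (α * n + β) ≤
      b * (6 * U + 6 * q * (1 + Real.log (q + 1))) := by
    intro b
    induction b with
    | zero => simp
    | succ b ih =>
      have hsplit : Finset.Ioc n₀ (n₀ + (((b + 1) * q : ℕ) : ℤ)) =
          Finset.Ioc n₀ (n₀ + ((b * q : ℕ) : ℤ)) ∪
            Finset.Ioc (n₀ + ((b * q : ℕ) : ℤ)) (n₀ + ((b * q : ℕ) : ℤ) + q) := by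
        rw [Finset.Ioc_union_Ioc_eq_Ioc (by push_cast; nlinarith) (by push_cast; nlinarith)]
        congr 1; push_cast; ring
      rw [hsplit, sum_union (Finset.Ioc_disjoint_Ioc_of_le le_rfl)]
      have h2 := sum_geomBound_linear_block_le (β := β) hU hq hcop hα (n₀ + ((b * q : ℕ) : ℤ))
      push_cast at ih h2 ⊢
      linarith
  have hpos : 0 ≤ 6 * U + 6 * q * (1 + Real.log (q + 1)) := blockConst_nonneg hU q
  calc ∑ n ∈ Finset.Ioc n₀ (n₀ + M), geomBound U (α * n + β)
      ≤ ∑ n ∈ Finset.Ioc n₀ (n₀ + ((B * q : ℕ) : ℤ)), geomBound U (α * n + β) := hpad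
    _ ≤ B * (6 * U + 6 * q * (1 + Real.log (q + 1))) := hblocks B
    _ ≤ ((M : ℝ) / q + 1) * (6 * U + 6 * q * (1 + Real.log (q + 1))) := by gcongr

/-- **Lemma 6.5 over a symmetric range**: `∑_{|μ| ≤ M} geomBound U (αμ) ≤ ((2M+1)/q + 1)(6U + 6q(1 + log(q+1)))`.
[cite: Ivic1985, Lemma 6.5] -/
theorem sum_geomBound_linear_Icc_le {α U : ℝ} (hU : 0 ≤ U) {a : ℤ} {q : ℕ} (hq : 0 < q) (hcop : IsCoprime a (q : ℤ))
    (hα : |α - a / q| ≤ 1 / (q : ℝ) ^ 2) (M : ℕ) :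
    ∑ μ ∈ Finset.Icc (-(M : ℤ)) M, geomBound U (α * μ) ≤
      ((2 * M + 1 : ℝ) / q + 1) * (6 * U + 6 * q * (1 + Real.log (q + 1))) := by
  have h := sum_geomBound_linear_le (β := 0) hU hq hcop hα (-(M : ℤ) - 1) (2 * M + 1)
  have hI : Finset.Ioc (-(M : ℤ) - 1) (-(M : ℤ) - 1 + ((2 * M + 1 : ℕ) : ℤ)) = Finset.Icc (-(M : ℤ)) M := by
    ext μ; simp only [Finset.mem_Ioc, Finset.mem_Icc]; push_cast; omega
  rw [hI] at h
  simp only [add_zero] at h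
  push_cast at h
  exact h

end VinogradovZetaSum
end Literature.NumberTheory.LFunctions
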